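import Literature.Barriers.CriticalPhenomena.ParafermionicHalfCauchyRiemann
import HarnessLib

/-!
# Sketch (crux-ideate stmt-CriticalPhenomena-14003, ideator 1): exact polynomial flux moments

First lemmas of the idea card `flux-moment-quadrature`: the degree ≤ 2 Cauchy–Pompeiu
identities are EXACT on the hexagonal lattice — analytic weights `h(c_v)` turn the boundary flux
into the interior TWIST moments `Σ h'(m)(m - c_v)² F`, anti-analytic weights `conj h(c_v)` into the
interior MONOPOLE moments `Σ conj(h'(m)) |m - c_v|² F` — for every function `F` on mid-edges that
satisfies the Duminil-Copin–Smirnov vertex relations on `Λ` (no simple-connectedness, no Taylor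
remainder). `h ≡ 1` is the flux identity `HexGreen.sum_relations_eq_hexFlux` / DCS eq. (2).
-/

namespace Summit.CriticalPhenomena.SAWScalingLimit.Cruxes.HexObservableLimitR.Ideator1Sketch

open Literature.Barriers.CriticalPhenomena Literature.Barriers.CriticalPhenomena.HexGreen
  Literature.Barriers.CriticalPhenomena.HexKernel
open Literature.Probability.LatticeModels Literature.Probability.RandomPlanarGeometry.SAW
open scoped BigOperators ComplexConjugate

noncomputable section

/-- Boundary pairing of the flux of `F` out of `Λ` against a weight `g` on vertices (evaluated at
the INSIDE endpoint of each boundary mid-edge): `Σ_{v∈Λ} Σ_{w∼v, w∉Λ} g(v)·(m_{vw} - c_v)·F(vw)`. -/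
def bdyPairing (Λ : Finset HexVertex) (g : HexVertex → ℂ) (F : Sym2 HexVertex → ℂ) : ℂ :=
  ∑ v ∈ Λ, ∑ w ∈ (nbrs v).filter (· ∉ Λ), g v * term F v w

/-- Interior ordered-pair sum `Σ_{v∈Λ} Σ_{w∼v, w∈Λ} c(v,w)·F(vw)` for a coefficient `c`. -/
def intPairing (Λ : Finset HexVertex) (c : HexVertex → HexVertex → ℂ) (F : Sym2 HexVertex → ℂ) : ℂ :=
  ∑ v ∈ Λ, ∑ w ∈ (nbrs v).filter (· ∈ Λ), c v w * F s(v, w)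

/-- FIRST LEMMA (h = z): the first analytic flux moment is the TOTAL TWIST — for every `F` with the
vertex relations on `Λ`,
`Σ_{∂} c_v (m - c_v) F = Σ_{ordered interior} (m - c_v)² F` (each interior edge twice; `(m-c_v)² =
(m-c_w)²` carries the class phase `e^{2iθ_e}`). Provable now (regroup `0 = Σ_v c_v·(relation at v)`). -/
def TwistFluxMoment : Prop :=
  ∀ (Λ : Finset HexVertex) (F : Sym2 HexVertex → ℂ), SatisfiesVertexRelations Λ F →
    bdyPairing Λ (fun v => hexCenter v) F =
      intPairing Λ (fun v w => (hexMidpoint s(v, w) - hexCenter v) ^ 2) F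

/-- FIRST LEMMA (h̄ = z̄): the first anti-analytic flux moment is the TOTAL MONOPOLE —
`Σ_{∂} conj(c_v) (m - c_v) F = Σ_{ordered interior} |m - c_v|² F = 2ρ² Σ_{interior edges} F`. -/
def MonopoleFluxMoment : Prop :=
  ∀ (Λ : Finset HexVertex) (F : Sym2 HexVertex → ℂ), SatisfiesVertexRelations Λ F →
    bdyPairing Λ (fun v => conj (hexCenter v)) F =
      intPairing Λ (fun v w => ((Complex.normSq (hexMidpoint s(v, w) - hexCenter v) : ℝ) : ℂ)) F

/-- Degree-2 analytic moment (h = z²): `Σ_{∂} c_v² (m - c_v) F = Σ_{ord int} 2m (m - c_v)² F`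
(first moment of the twist), still exact. -/
def TwistFluxMoment2 : Prop :=
  ∀ (Λ : Finset HexVertex) (F : Sym2 HexVertex → ℂ), SatisfiesVertexRelations Λ F →
    bdyPairing Λ (fun v => hexCenter v ^ 2) F =
      intPairing Λ (fun v w => 2 * hexMidpoint s(v, w) * (hexMidpoint s(v, w) - hexCenter v) ^ 2) F

/-- Degree-2 anti-analytic moment (h̄ = z̄²): `Σ_{∂} conj(c_v)² (m - c_v) F = Σ_{ord int} 2 conj(m) |m - c_v|² F`
(first anti-moment of the monopole), exact. -/
def MonopoleFluxMoment2 : Prop :=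
  ∀ (Λ : Finset HexVertex) (F : Sym2 HexVertex → ℂ), SatisfiesVertexRelations Λ F →
    bdyPairing Λ (fun v => conj (hexCenter v) ^ 2) F =
      intPairing Λ (fun v w => 2 * conj (hexMidpoint s(v, w)) *
        ((Complex.normSq (hexMidpoint s(v, w) - hexCenter v) : ℝ) : ℂ)) F


/-- Degree-3 anti-analytic moment (h̄ = z̄³), still EXACT: the cubic Taylor term survives as the interior sum
`Σ_ord |m−c_v|² conj(m−c_v)² F`, whose summand is `ρ³·conj(τ_v)·(m − c_v)F` (`τ_v = u³`, a sign per sublattice), i.e. a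
multiple of the vertex relation at `v` — so it equals MINUS the corresponding boundary sum (`CubicTermIsBoundary`), and
conj-polynomial monopole moments are exact boundary sums up to degree 4. -/
def MonopoleFluxMoment3 : Prop :=
  ∀ (Λ : Finset HexVertex) (F : Sym2 HexVertex → ℂ), SatisfiesVertexRelations Λ F →
    bdyPairing Λ (fun v => conj (hexCenter v) ^ 3) F =
      intPairing Λ (fun v w => 3 * conj (hexMidpoint s(v, w)) ^ 2 *
          ((Complex.normSq (hexMidpoint s(v, w) - hexCenter v) : ℝ) : ℂ) +
        ((Complex.normSq (hexMidpoint s(v, w) - hexCenter v) : ℝ) : ℂ) *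
          conj (hexMidpoint s(v, w) - hexCenter v) ^ 2) F

/-- The cubic term is a boundary term: `Σ_{v∈Λ}Σ_{w∼v, w∈Λ} |m−c_v|² conj(m−c_v)² F = −Σ_{v∈Λ}Σ_{w∼v, w∉Λ} |m−c_v|² conj(m−c_v)² F`
for every `F` with the vertex relations (each star sum is `ρ³ conj(τ_v) · (relation at v) = 0`). -/
def CubicTermIsBoundary : Prop :=
  ∀ (Λ : Finset HexVertex) (F : Sym2 HexVertex → ℂ), SatisfiesVertexRelations Λ F →
    intPairing Λ (fun v w => ((Complex.normSq (hexMidpoint s(v, w) - hexCenter v) : ℝ) : ℂ) *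
        conj (hexMidpoint s(v, w) - hexCenter v) ^ 2) F =
      - ∑ v ∈ Λ, ∑ w ∈ (nbrs v).filter (· ∉ Λ),
          ((Complex.normSq (hexMidpoint s(v, w) - hexCenter v) : ℝ) : ℂ) *
            conj (hexMidpoint s(v, w) - hexCenter v) ^ 2 * F s(v, w)

/-- The general regrouping behind all four (any weight `g`, exact): the boundary pairing equals
`- Σ_{v} Σ_{w∈Λ} (m - c_v)(g v - g w) F / 2`-type interior sum; stated in ordered form
`Σ_{∂} g(v)(m-c_v)F = - Σ_{v∈Λ}Σ_{w∼v,w∈Λ} g(v)(m - c_v) F`. [= `0 = Σ_v g(v)·relation(v)`] -/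
def WeightedGreenIdentity : Prop :=
  ∀ (Λ : Finset HexVertex) (F : Sym2 HexVertex → ℂ) (g : HexVertex → ℂ), SatisfiesVertexRelations Λ F →
    bdyPairing Λ g F = - intPairing Λ (fun v w => g v * (hexMidpoint s(v, w) - hexCenter v)) F

/-- The observable instance: with DCS Lemma 1 (PROVED in the tree) the four moment identities hold for
`F = F(a, ·, x_c, 5/8)` in every simply connected `Λ` with boundary root `a`; e.g. the total twist of
the observable is a rigid-phase boundary sum (boundary values have deterministic winding). -/
def ObservableTwistIsBoundarySum : Prop :=
  ∀ (Λ : Finset HexVertex), hexDomainSimplyConnected Λ → ∀ a ∈ hexDomainBoundary Λ,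
    let F := hexParafermionicObservable Λ a (Real.sqrt (2 + Real.sqrt 2))⁻¹ (5 / 8)
    bdyPairing Λ (fun v => hexCenter v) F =
      intPairing Λ (fun v w => (hexMidpoint s(v, w) - hexCenter v) ^ 2) F

/-- Sanity: the observable satisfies the barrier file's `SatisfiesVertexRelations` (bridge `lemma1_iff`). -/
theorem observable_satisfies (hL : DuminilCopinSmirnov2012_lemma1) (Λ : Finset HexVertex)
    (hΛ : hexDomainSimplyConnected Λ) (a : Sym2 HexVertex) (ha : a ∈ hexDomainBoundary Λ) :
    SatisfiesVertexRelations Λ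
      (hexParafermionicObservable Λ a (Real.sqrt (2 + Real.sqrt 2))⁻¹ (5 / 8)) :=
  (lemma1_iff.1 hL) Λ hΛ a ha

/-- The instance follows from the abstract identity. -/
theorem observableTwist_of (h : TwistFluxMoment) (hL : DuminilCopinSmirnov2012_lemma1) :
    ObservableTwistIsBoundarySum := by
  intro Λ hΛ a ha
  exact h Λ _ (observable_satisfies hL Λ hΛ a ha)

end

end Summit.CriticalPhenomena.SAWScalingLimit.Cruxes.HexObservableLimitR.Ideator1Sketch
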